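import Summits.CriticalPhenomena.PercolationContinuityZ3.Theorems.PercNearOneGluingNoHeavyPcintSignedConfigSeriesE
import Summits.CriticalPhenomena.PercolationContinuityZ3.Theorems.PercNearOneGluingNoHeavyPcintSubleadingChordLaw
import Mathlib.RingTheory.PowerSeries.Derivative
import HarnessLib

/-!
# CriticalPhenomena/PercolationContinuityZ3 — Theorems/PercNearOneGluingNoHeavyPcintSignedConfigAlgebra.lean: the generating-function ALGEBRA behind the closed form of law C5-L4c — `U(1 − G) = 1`, `A' = U²(1 + H₂)`, evenization

Lane prim-pcint, STRUCTURE rule «numerics ⇒ structure ⇒ conjecture» (prim-pcint-2 GEN 22); sequel of …PcintSignedConfigSeriesE.  The closed form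
`oneDefect` of …PcintSubleadingChordLaw is a polynomial in the series `U = Σ a(i+1)xⁱ`, `A' = Σ (i+1)a(i+1)xⁱ`, `H_j = Σ C(2i−1, j)a(i)xⁱ` of the
Touchard–Riordan numbers `a = connChord`.  Here: the x-series `Ux`, `Hx j`, `Apx` in `ℤ⟦X⟧`; the CHAIN identity **`Ux · (1 − Hx 1) = 1`**
(`Ux_mul`, from the recurrence `connChord_succ`); the MARKED-CHORD identity **`Apx = Ux² · (1 + Hx 2)`** (`Apx_eq`, by formal differentiation:
`U' = U²G'` and `x·G' = G + H₂`); the closed form as a coefficient, `oneDefectGF n = coeff n closedFormX` (`oneDefectGF_eq_coeff`); and the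
EVENIZATION ring map `ev` (`x ↦ X²`, the size variable of the forest decomposition counts two points per chord) with `HS j = ev (Hx j)` (the core
series of …PcintSignedConfigSeriesE; `#goodSet (Fin 2k) = a(k)` from …PcintChordDiagramCount).

HONEST FRAMING: algebra of formal power series only.  No `sorry`; standard axioms.  Written by prim-pcint-2 gen 22 (prover-prim-pcint-2-g22-0), 2026-08-27.
-/

open PowerSeries

namespace Summit.CriticalPhenomena.PercolationContinuityZ3.Theorems.Pcint.ChordDiag

open Summit.CriticalPhenomena.PercolationContinuityZ3.Theorems.Pcint.MemoryTail (connChord connChordAux connChord_values conv cU cA' cH3 cH4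
  oneDefectGF oneDefect)

/-! ### The x-series of the Touchard–Riordan numbers -/

/-- `U(x) = Σ a(i+1) xⁱ`. [folklore] -/
noncomputable def Ux : ℤ⟦X⟧ := PowerSeries.mk fun i => (connChord (i + 1) : ℤ)

/-- `H_j(x) = Σ C(2k−1, j)·a(k)·x^k` (`H_1 = G = Σ (2k−1)a(k)x^k`). [folklore] -/
noncomputable def Hx (j : ℕ) : ℤ⟦X⟧ := PowerSeries.mk fun k => (((2 * k - 1).choose j : ℕ) : ℤ) * (connChord k : ℤ)

/-- `A'(x) = Σ (i+1)·a(i+1)·xⁱ`. [folklore] -/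
noncomputable def Apx : ℤ⟦X⟧ := PowerSeries.mk cA'

/-- Coefficients of `Ux`. [folklore] -/
@[simp] theorem coeff_Ux (i : ℕ) : coeff i Ux = connChord (i + 1) := by simp [Ux]

/-- Coefficients of `Hx j`. [folklore] -/
@[simp] theorem coeff_Hx (j k : ℕ) : coeff k (Hx j) = (((2 * k - 1).choose j : ℕ) : ℤ) * (connChord k : ℤ) := by simp [Hx]

/-- `a(0) = 0`. [folklore] -/
theorem connChord_zero : connChord 0 = 0 := rfl

/-! ### The chain identity `U(1 − G) = 1` -/

/-- **The Touchard–Riordan recurrence in convolution form**: `a(n+1) = Σ_{i+k=n} a(i+1)·(2k−1)·a(k)` for `n ≥ 1`. [folklore] -/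
theorem connChord_succ_conv {n : ℕ} (hn : 1 ≤ n) :
    ∑ p ∈ Finset.antidiagonal n, connChord (p.1 + 1) * ((2 * p.2 - 1) * connChord p.2) = connChord (n + 1) := by
  rw [← Finset.Nat.sum_antidiagonal_swap]
  simp only [Prod.fst_swap, Prod.snd_swap]
  rw [Finset.Nat.sum_antidiagonal_eq_sum_range_succ (fun k i => connChord (i + 1) * ((2 * k - 1) * connChord k)) n,
    Finset.sum_range_succ']
  simp only [Nat.zero_sub, mul_zero, add_zero, connChord_zero]
  rw [connChord_succ hn, ← sum_two_mul_add_one_of_symm (fun j => connChord (j + 1) * connChord (n - j)) n fun j hj => by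
      rw [show n - 1 - j + 1 = n - j by omega, show n - (n - 1 - j) = j + 1 by omega, mul_comm]]
  refine Finset.sum_congr rfl fun j hj => ?_
  rw [Finset.mem_range] at hj
  rw [show n - (j + 1) + 1 = n - j by omega, show 2 * (j + 1) - 1 = 2 * j + 1 by omega]
  ring

/-- **`U · (1 − G) = 1`.** [folklore] -/
theorem Ux_mul : Ux * (1 - Hx 1) = 1 := by
  ext n
  rw [mul_sub, mul_one, map_sub, coeff_one, coeff_Ux, coeff_mul]
  simp only [coeff_Ux, coeff_Hx, Nat.choose_one_right]
  rcases Nat.eq_zero_or_pos n with hn | hn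
  · subst hn; simp [connChord_values.1, connChord_zero]
  · rw [if_neg (by omega)]
    have := connChord_succ_conv hn
    have h' : (∑ p ∈ Finset.antidiagonal n, (connChord (p.1 + 1) : ℤ) * ((((2 * p.2 - 1 : ℕ)) : ℤ) * (connChord p.2 : ℤ))) =
        (connChord (n + 1) : ℤ) := by exact_mod_cast this
    rw [h', sub_self]

/-! ### The marked-chord identity `A' = U²(1 + H₂)` by formal differentiation -/

/-- `x · G'(x) = G + H₂` coefficientwise: `k(2k−1) = (2k−1) + C(2k−1, 2)`. [folklore] -/
theorem X_mul_derivative_Hx_one : X * derivativeFun (Hx 1) = Hx 1 + Hx 2 := by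
  ext k
  rw [map_add, coeff_Hx, coeff_Hx, Nat.choose_one_right]
  rcases k with _ | k
  · simp [coeff_zero_X_mul, connChord_zero]
  · rw [coeff_succ_X_mul, coeff_derivativeFun, coeff_Hx, Nat.choose_one_right, Nat.choose_two_right]
    have e1 : (2 * (k + 1) - 1) * (2 * (k + 1) - 1 - 1) / 2 = (2 * k + 1) * k := by
      rw [show 2 * (k + 1) - 1 - 1 = 2 * k by omega, show (2 * (k + 1) - 1) * (2 * k) = 2 * ((2 * (k + 1) - 1) * k) by ring,
        Nat.mul_div_cancel_left _ (by norm_num), show 2 * (k + 1) - 1 = 2 * k + 1 by omega]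
    rw [e1, show 2 * (k + 1) - 1 = 2 * k + 1 by omega]
    push_cast
    ring

/-- `U' = U²·G'`. [folklore] -/
theorem derivativeFun_Ux : derivativeFun Ux = Ux ^ 2 * derivativeFun (Hx 1) := by
  -- differentiate `U (1 − G) = 1`
  have h1 : derivativeFun (Ux * (1 - Hx 1)) = 0 := by rw [Ux_mul, derivativeFun_one]
  have h2 : derivativeFun (1 - Hx 1) = -derivativeFun (Hx 1) := by
    have := derivativeFun_add (1 - Hx 1) (Hx 1)
    rw [sub_add_cancel, derivativeFun_one] at this
    linear_combination -this
  rw [derivativeFun_mul, h2, smul_eq_mul, smul_eq_mul] at h1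
  -- `(1 − G)·U' = U·G'`; multiply by `U`
  linear_combination Ux * h1 - derivativeFun Ux * Ux_mul

/-- `A' = (x·U)'`. [folklore] -/
theorem Apx_eq_derivativeFun : Apx = derivativeFun (X * Ux) := by
  ext n
  rw [coeff_derivativeFun, coeff_succ_X_mul, coeff_Ux]
  simp [Apx, cA']
  ring

/-- **`A' = U² · (1 + H₂)`.** [folklore] -/
theorem Apx_eq : Apx = Ux ^ 2 * (1 + Hx 2) := by
  have hX : derivativeFun (X : ℤ⟦X⟧) = 1 := derivative_X (R := ℤ)
  rw [Apx_eq_derivativeFun, derivativeFun_mul, smul_eq_mul, smul_eq_mul, derivativeFun_Ux, hX]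
  linear_combination Ux ^ 2 * X_mul_derivative_Hx_one - Ux * Ux_mul

/-! ### The closed form as a coefficient -/

/-- Convolution of coefficient sequences is multiplication of series. [folklore] -/
theorem mk_conv (f g : ℕ → ℤ) : PowerSeries.mk (conv f g) = PowerSeries.mk f * PowerSeries.mk g := by
  ext n
  rw [coeff_mk, coeff_mul]
  simp [conv]

/-- `mk cU = Ux`, `mk cH3 = Hx 3`, `mk cH4 = Hx 4`. [folklore] -/
theorem mk_cU : PowerSeries.mk cU = Ux := by ext n; simp [cU]

/-- `mk cH3 = Hx 3`. [folklore] -/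
theorem mk_cH3 : PowerSeries.mk cH3 = Hx 3 := by ext n; simp [cH3]

/-- `mk cH4 = Hx 4`. [folklore] -/
theorem mk_cH4 : PowerSeries.mk cH4 = Hx 4 := by ext n; simp [cH4]

/-- The closed form `5A'³ + U³A'(9H₃ − 7) + U⁴(3H₄ + 2)` as an x-series (written as in `oneDefectGF`). [folklore] -/
noncomputable def closedFormX : ℤ⟦X⟧ :=
  C 5 * (Apx * (Apx * Apx)) + C 9 * ((Ux * (Ux * Ux)) * (Apx * Hx 3)) - C 7 * ((Ux * (Ux * Ux)) * Apx) +
    C 3 * ((Ux * (Ux * (Ux * Ux))) * Hx 4) + C 2 * (Ux * (Ux * (Ux * Ux)))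

/-- The closed form in the usual shape. [folklore] -/
theorem closedFormX_eq : closedFormX = 5 * Apx ^ 3 + Ux ^ 3 * Apx * (9 * Hx 3 - 7) + Ux ^ 4 * (3 * Hx 4 + 2) := by
  unfold closedFormX
  simp only [map_ofNat]
  ring

/-- **`oneDefectGF n = coeff n closedFormX`.** [folklore] -/
theorem oneDefectGF_eq_coeff (n : ℕ) : oneDefectGF n = coeff n closedFormX := by
  have e : ∀ f : ℕ → ℤ, f n = coeff n (PowerSeries.mk f) := fun f => (coeff_mk n f).symm
  unfold oneDefectGF
  rw [e (conv cA' (conv cA' cA')), e (conv (conv cU (conv cU cU)) (conv cA' cH3)), e (conv (conv cU (conv cU cU)) cA'),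
    e (conv (conv cU (conv cU (conv cU cU))) cH4), e (conv cU (conv cU (conv cU cU)))]
  simp only [mk_conv, mk_cU, mk_cH3, mk_cH4, show PowerSeries.mk cA' = Apx from rfl]
  unfold closedFormX
  simp only [map_add, map_sub, coeff_C_mul]

end Summit.CriticalPhenomena.PercolationContinuityZ3.Theorems.Pcint.ChordDiag
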